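import Mathlib
import HarnessLib
import HarnessLib.Audit
import Summits.ABC.Statement
import Literature.NumberTheory.EllipticCurves.Szpiro
import HarnessLib.Audit.Status.Attr

/-!
Route: PlacewiseSzpiro

# Route PlacewiseSzpiro — Szpiro one place at a time — each local height of j gets the full 6+ε
conductor budget

D-0145 LINE (ideator abc-idea-2, technique card «extremal-example mining»; no summit is proved by a
line; A-PS is NOT abc).
Frey's height conjecture h(j_E) ≤ (6+ε) log N_E + C (⟺ generalized Szpiro ⟺ abc, tree door
`Summit.ABC.generalizedSzpiroBG_iff_abc`) is a SUM over places of local heights λ_v(j_E): the finite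
towers
n_p·log p (n_p = ord_p Δ_min) and the archimedean tower log⁺|j_E|. X = X1 ∧ X2 asks for the bound
ONE PLACE AT A TIME
with the full budget: X1 = SingleTowerSzpiro (every finite tower ≤ (6+ε) log N_E + C — NEW typed
statement, the repaired form
of the refuted per-place shape `Summit.ABC.FunctionField.LocalSzpiroAt`, which had the conductor
EXPONENT on the right) and
X2 = ArchimedeanTower (= `Summit.ABC.Analytic.SzpiroAtInfinityRat (6+ε)`, Pasten's «Szpiro at
infinity», cited by name).
X1 alone already yields the named open rung `Summit.ABC.Harvest.SubexponentialSzpiro` (support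
PlacewisePayoff); the
re-summation of the placewise bounds to abc is the declared residual PlacewiseResidual — NOT
claimed.
Lean: `Summit.ABC.ABC.Theses.PlacewiseSzpiro.SingleTowerSzpiro ∧
Summit.ABC.ABC.Theses.PlacewiseSzpiro.ArchimedeanTower`

## Assembly
Pure logic, kernel-checked in glue.lean: `closes h₁ h₂ hpay hres := hres (hpay h₁) h₁ h₂` — the two
placewise cruxes feed
the payoff (X1 ⇒ SubexponentialSzpiro) and the declared residual re-sums them to `_root_.ABC`. The
residual is where abc
lives and is labelled as such; the attackable content of the line is X1, X2 and the payoff.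

Rationale: WHY THIS LINE. Mechanism: decompose the global height inequality PLACEWISE and attack the weakest
universally-quantified slice that still pays a named rung: a single multiplicative tower is ONE
p-adic Tate period q_{E,p} (ord_p q = n_p), so X1 `SingleTowerSzpiro` (n_p·log p ≤ (6+ε)·log N_E +
C, repair of the refuted per-place shape `LocalSzpiroAt` with log N_E on the right) is a statement
about the p-adic distance of j_E to the cusp at ONE place, bounded by the global conductor — the
currency of p-adic uniformization (Tate; monodromy pairing at p, SGA7; Mazur–Tate–Teitelbaum) rather
than of linear forms in logarithms; X2 `ArchimedeanTower` is the archimedean slice (=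
`SzpiroAtInfinityRat (6+ε)` ∀ε, PastenThesis2014 Conj. 104 at K = 6+ε). Mined fact that selects the
line (ENG-SZPIRO, 338 curves σ ≥ 7.5): the Szpiro excess is carried by ONE tower in 94 % of high-σ
curves; single-tower ratio π(E) = max_p n_p log p / log N reaches 7.97 (858k2). CRITIC VERDICT
(idea-crit-6, 2026-08-27T20:59:39Z): PASS-WITH-PRICE — BOOKED AT THE RUNG
`Summit.ABC.Harvest.SubexponentialSzpiro` («A1′ (proposed)», between A1.L and A-PS) ONLY, via the
provable payoff item `PlacewisePayoff` (stmt-ABC-22412: X1 ⇒ log|Δ_min| ≤ C(ε)·N^ε); the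
`_root_.ABC` closure is NOMINAL and runs through the DECLARED RESIDUAL `PlacewiseResidual`
(stmt-ABC-22413, abc-strength, NOT claimed, never to be staffed). The gate does not (yet) accept a
rung decl as `closes` target for ABC/ABC (accepted conclusions: `ABC` only; director rq101 asks for
R5 alt_closers class `rung`) — until then the inlined door + declared residual stand, and this
header says so. PRICE (verbatim, critic + director g7-D3/D4): X1 is nearly A-PS-hard; no
inequality-producing instance of the place-local currency exists yet; FIRST DELIVERABLE = ANY
non-trivial single-tower bound n_p·log p ≤ F(N_E) with F below Stewart–Yu (typed as
`stub_firstDeliverable_towerBelowStewartYu` in the registered skeleton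
Cruxes/SingleTowerSzpiro/Lines/birth.lean); CONSTANTS: instrument of record DESK-CALIB-2 (kit
j290396, Cremona N < 5·10⁵): band maxima of π(E) FLAT (t = −0.03 per doubling) ⇒ floor only — C ≥
18.93 at ε = 0, K ≥ 7.97 at C = 0 (computed ≠ proved; these replace the slice value «≥ 13»). X2
`ArchimedeanTower` is NOT load-bearing for the booked rung (it feeds only the nominal residual); it
stays typed here as the archimedean slice and is to be re-filed as its own mini-line on the
`SzpiroAtInfinityRat K` door (Pasten Conj. 104; K = 6 needs C ≥ 21.7) if the director wants it
staffed — provers: do NOT take stmt-ABC-22411 or stmt-ABC-22413 from this route. PROVER ORDER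
(director g7-D3, KEY-abc-harv-pr-3-PLACEWISE-PAYOFF): (i) land stmt-ABC-22412 `PlacewisePayoff`
(`subexponentialSzpiro_of_singleTowerSzpiro`, provable now: sum X1 over p | N, ω(N) ≤ (1+o(1)) log
N/log log N); (ii) then X1's registered skeleton stubs (multiplicative tower f_v = 1 first). No
summit and no rung is proved by this line; typed ≠ proved; NOT abc — a sub-exponential Szpiro bound
is the payoff.
RANKED CRUXES. rank 2 `SingleTowerSzpiro` (X1, the step where all difficulty sits; BC5 rung PROVED
from the named fact `mestreOesterle1989_thm_1`: prime conductor ⇒ every tower ≤ 5 log N); rank 3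
`ArchimedeanTower` (X2, not load-bearing for the rung, see PRICE); support `PlacewisePayoff`
(provable now, FIRST prover target); support `PlacewiseResidual` (declared residual, abc-strength,
not attacked); `Assembly`. NEAREST PRINT TO S1 (instrument pickup ENG-PLACE-1-FIXEDP, eng-2):
Bennett–Yazdani 2012, «A Local Version of Szpiro's Conjecture» (Exp. Math.;
doi:10.1080/10586458.2012.645780), Thm 1.3 p.3: N_E = M·p, E with a rational n-isogeny (n > 1), p ≥
C(M) ⇒ v_p(Δ_E) ≤ 6 — i.e. S1 HOLDS on fixed-cofactor isogeny families (genus-0 modular-curve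
discriminant formulae; Cor. 2.2 p.4: rational N-torsion, N > 3 ⇒ v_{p_i}(Δ_E) ∣ N for all large
p_i); their Conj. 1.2 (∃ p ∣ N_E with v_p(Δ) ≤ 6·v_p(N_E)) is the ∃-place dual of X1's ∀-place form.
FIXED-PLACE FLOORS (negative lane, eng-2 p585758/p586371/p586599,
`Theorems/SingleTowerSzpiro/Negative/FixedPrimeFloors*.lean`): C*_p(0) = 2.79 (p=2, 910e3 2⁶³) ·
18.93 (p=3, 32658b1 3⁷⁴) · 11.01 (5) · 2.68 (7) · 2.76 (11) · 13.34 (13, 858k2 13²¹) · ≤ 5.92 (p ≥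
17); band maxima FLAT at every p ≤ 23 (no fixed-p growth, N < 5·10⁵; out-of-range beds N ≤ 3.9·10⁸
beat no in-range floor); record towers are sporadic S-unit coincidences (32658b1: c₆² − c₄³ =
2⁸·3⁷⁷·5443). No census can kill X1 (a kill = Szpiro violations concentrated at one place).
KILL CRITERIA. A certified infinite family with a single tower n_p log p ≥ (6+δ)·log N_E (δ > 0
fixed; a Masser/Bennett–Yazdani-type construction concentrated at one prime) refutes X1 and closes
the route (`close --reason refuted:SingleTowerSzpiro`); GROWTH of the band maxima of π(E) beyond the
Cremona range (ENG-PLACE-1-EXT, LOW priority) is evidence against X1. A family with log⁺|j_E| ≥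
(6+δ) log N_E refutes X2 only (the rung booking is unaffected). Proof of SzpiroConjecture elsewhere
moots X1.
NOT DECOMPOSED YET. The residual (re-summation Subexp → X1 → X2 → ABC) is deliberately not
decomposed: it is summit-strength and declared, not attacked. LAYER 2 OF X1 IS COMPLETE (skeleton
`Cruxes/SingleTowerSzpiro/Lines/birth.lean`, lead abc-harv-pr-3): X1 ⟺ S1 `stub_multiplicativeTower`
«f_v = 1 → (−v(j_E))·log p_v ≤ (6+ε)·log N_E + C» is KERNEL-CERTIFIED
(`singleTowerSzpiro_iff_multiplicativeTower`, p581193) — the non-multiplicative places are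
bookkeeping and LANDED: potentially-good towers ≤ 5·log N_E + C (S2-odd p577820, S2-two p578899) and
potentially-multiplicative additive towers by quadratic-twist transfer from S1 (S3-odd p580133,
S3-two p580442); prime-conductor rung p581908 (towers ≤ 5 log N_E, mod `mestreOesterle1989_thm_1`).
The inequality-producing mechanism inside S1 is the open problem of the line and S1 is NOT staffed
(PRICE). FIRST-DELIVERABLE LESSON (calibration p584725, pr-3): the critic's «any single-tower bound
strictly below Stewart–Yu», typed by me over all E/ℚ at scale N^{1/3−δ}
(`stub_firstDeliverable_towerBelowStewartYu`), is MISSTATED — at polynomial scales place-locality is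
vacuous (ω(N_E) ≤ log₂N_E towers): FD ⟺ ∃ α < 1/3, SzpiroEpsShape α (beat Murty–Pasten's α = 1 for
all E/ℚ AND Stewart–Yu's 1/3 on Frey curves); the stub is RETIRED (misstated) with NO
polynomial-scale replacement, because SMALL places p ≤ rad^{1/3−2δ} are Baker-cheap (tower_p ≤
C_η·p·rad^η on the Frey locus from `PastenApproximationBound`, p585329, PROVED-MOD-FACT) while the
LARGE-place complement is ≡ EpsShapeBound θ < 1/3 (improving Stewart–Yu outright) modulo the cheap
half and a log factor; and at the INTERMEDIATE scale a FIXED place is already a named hard problem —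
«v₂(abc)·log 2 ≤ C·(log rad)^A» on the Mersenne triples (1, 2ⁿ−1, 2ⁿ) reads log rad(2ⁿ−1) ≥
(n/C)^{1/A} against the record (1+o(1))·log n (Stewart 2013; abc predicts (1−ε)·n·log 2), i.e.
Baker–Philippon ω-uniformity at one place. Census: below S1 there is no stub that is neither
Baker-cheap nor a named open problem; LINE 1 is complete as a typed line and dormant for provers
until a mechanism for S1 is named; the instrument of record continues (ENG-PLACE-1-FIXEDP: fixed-p
floors and «what a fixed-p kill must look like: N′_E ≤ C·p^{n_p/(6+ε)} along a family ⟺ radical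
collapse of p-power-adjacent numbers»).
CHEAPEST FALSIFIER. ENG instrument row of record DESK-CALIB-2 (kit j290396): band maxima of π(E) =
max_p ord_p(Δ_min)·log p / log N_E over dyadic conductor bands — FLAT in range (t = −0.03), floor C
≥ 18.93 @ ε = 0; my slice run (σ ≥ 7.5, 338 curves): 7.974 (N = 858), 7.822 (32658), 7.648 (97974),
6.853 (407460). For X2: ENG-JINF J2 (j287027) band maxima of λ_j FLAT at ≈ 7.

Novelty: Searches (2026-08-27): lit search --hybrid "Szpiro conjecture exponent of a single prime in the
minimal discriminant bounded by log conductor" (8 docs: SilvermanAEC2009 pp.221–223, Silverman1994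
pp.364–365, BombieriGubler2006 pp.418–437, Evertse–Győry 2015 p.270 — none states a per-prime form);
lit vsearch "<per-prime valuation times log p bounded by log conductor>" (8 docs, same books, no
per-place statement); lit galaxy search "Szpiro ratio|exponent of the minimal discriminant|local
height of the j-invariant" --star all (4 rows, none relevant); lit galaxy search "Szpiro conjecture
at infinity|one prime at a time|single prime of bad reduction" --star all (noise); tree: rg
LocalSzpiro/SzpiroAtInfinity (found the refuted `LocalSzpiroAt` and the typed
`SzpiroAtInfinityRat`); ledger negatives --problem ABC (2 entries, unrelated).
Nearest prior art found: tree `Summit.ABC.FunctionField.LocalSzpiroAt` / `not_localSzpiroAt`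
(per-place Szpiro with conductor EXPONENT on the right — refuted); BennettYazdani2012 (∃ a prime p |
N with v_p(Δ) ≤ 6 v_p(N) — opposite quantifier); PastenThesis2014 Conj. 104 (the archimedean slice,
∃K); PastenShimura2024 §1 (the SubexponentialSzpiro rung).
Delta: the universally-quantified single-PLACE form with the GLOBAL conductor on the right (every
local height of j_E ≤ (6+ε) log N_E + C), typed, shown to pay the SubexponentialSzpiro rung, and
selected by the mined single-tower extremal statistic — no listed route, card or census door states
or attacks Sz  [refs: SilvermanAEC2009, Silverman1994, BombieriGubler2006, BennettYazdani2012, PastenThesis2014, PastenShimura2024]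

Barriers (technique_class: local-heights, p-adic-uniformization, placewise-decomposition): - technique_class: local-heights, p-adic-uniformization, placewise-decomposition
- Literature.Barriers.ABC.BakerMethodBounds: it does not evade it if attacked by linear forms in
logarithms (Stewart–Yu give n_p log p ≤ log|Δ| ≪ N^{1/3}(log N)³ only, and X1 implies
SubexponentialSzpiro, beyond the method's recorded ceiling); the bet is a place-bound p-adic period
argument (one Tate parameter against the global conductor), outside the Baker class.
- Literature.Barriers.ABC.SzpiroEpsilonCannotBeDropped: respected — X1 and X2 carry 6+ε and a free
constant; the Masser and Bennett–Yazdani families (single deep tower, f_p = 1) satisfy X1 with ratio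
≈ 3.
- Literature.Barriers.ABC.HallExponentSharp: X2 is stated with log N_E (conductor), not with |Δ|
(Hall currency); the sharpness of Hall's exponent does not bear on the conductor form beyond the
free constant (C ≥ 21.7 in range).
- Summit.ABC.FunctionField.not_localSzpiroAt (typed refuted shape, acts as a barrier for per-place
methods): evaded by construction — the right-hand side is the global log N_E, not K·f_v + C; any
place-bound method whose output depends on f_v alone is killed by it, so the line REQUIRES a global
input at the single place (this is the crux, stated as such).
- Negatives index: stmt-ABC-1205 (DegBelyiLower) and stmt-ABC-1689 (SeparatingQuasiLogDerivatives) —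
unrelated statements; nothing per-place is in the index at filing.

sub-problem: ABC · status: draft · opened planner-abc-idea-2-g0-0 2026-08-27T20:48:15Z · rev 2 · ledger route-ABC-PlacewiseSzpiro
GENERATED by the gate from the ledger (D-0016/17). Provers cite these decls: `theorem foo : Summit.ABC.ABC.Theses.PlacewiseSzpiro.<Decl> := …` in Summits/ABC/ABC/Theorems/<Name>.lean.
-/

namespace Summit.ABC.ABC.Theses.PlacewiseSzpiro

open scoped BigOperators Topology Manifold Classical MeasureTheory ProbabilityTheory Matrix InnerProductSpace ComplexConjugate ContinuousMap
open Filter Set Function TopologicalSpace MeasureTheory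

attribute [summit_statement] _root_.ABC

open Literature.Abc

/-- item stmt-ABC-22410 · crux · rank 2 · open · by planner
why it might fail: an infinite family with ONE multiplicative tower n_p log p ≥ (6+δ) log N_E (a Masser-type construction concentrated at one prime) refutes it; in range π(E) reaches 7.97 (858k2), 7.82 (32658b1, 3^74), so C(ε) ≥ 13 at ε→0; it implies the open rung SubexponentialSzpiro, hence is at least that hard.
sources: PastenShimura2024, BennettYazdani2012, Masser1990, SilvermanAEC2009
[crux] for every ε > 0 there is C(ε) such that for every elliptic curve E/ℚ and every prime p,
ord_p(Δ_min(E))·log p ≤ (6+ε)·log N_E + C — each finite local height of j_E separately obeys the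
generalized-Szpiro budget. [difficulty: open-problem] -/
@[route_item "route-ABC-PlacewiseSzpiro", crux]
def SingleTowerSzpiro : Prop :=
  ∀ ε : ℝ, 0 < ε → ∃ C : ℝ, ∀ (W : WeierstrassCurve ℚ) [W.IsElliptic] (v : IsDedekindDomain.HeightOneSpectrum ℤ), (W.ordMinimalDiscriminant v : ℝ) * Real.log (Rat.HeightOneSpectrum.natGenerator v : ℝ) ≤ (6 + ε) * Real.log (W.conductorNorm ℤ : ℝ) + C

/-- item stmt-ABC-22411 · crux · rank 3 · open · by planner
why it might fail: Pasten Conj. 104 asserts only SOME exponent K; at K = 6 the Cremona range forces C ≥ 21.7 (11a2, kernel floor `not_szpiroAtInfinityRatEff_zero_of_le`; ENG-JINF j287027: band maxima FLAT at λ_j ≈ 7); a Hall-type family with log⁺|j| ≥ (6+δ) log N unboundedly often would refute the 6+ε form.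
sources: PastenThesis2014, CremonaAlgorithms1997
[crux] for every ε > 0, Pasten's «Szpiro conjecture at infinity» with exponent 6+ε: ∃ C, ∀ E/ℚ,
log⁺|j_E| ≤ (6+ε) log N_E + C — the archimedean local height of j_E obeys the same budget (verbatim
`∀ ε>0, Summit.ABC.Analytic.SzpiroAtInfinityRat (6+ε)`, inlined because route files cannot import
`Summits.ABC.Analytic`; implied by ABC: `Summit.ABC.Analytic.szpiroAtInfinityRat_of_abc`).
[difficulty: open-problem] -/
@[route_item "route-ABC-PlacewiseSzpiro", crux]
def ArchimedeanTower : Prop :=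
  ∀ ε : ℝ, 0 < ε → ∃ C : ℝ, ∀ (W : WeierstrassCurve ℚ) [W.IsElliptic], Real.posLog ((W.j : ℚ) : ℝ) ≤ (6 + ε) * Real.log (W.conductorNorm ℤ : ℝ) + C

/-- item stmt-ABC-22412 · support · rank 9 · closed · proved by Summit.ABC.ABC.Theorems.placewisePayoff_proof (prover) · by planner
sources: PastenShimura2024, SilvermanAEC2009
[support] SingleTowerSzpiro implies the named rung `Summit.ABC.Harvest.SubexponentialSzpiro`
(inlined verbatim): summing the towers over the ω(N_E) ≤ log₂ N_E bad primes gives log|Δ_min| ≤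
(6+ε)(log N_E)²/log 2 + C·log₂ N_E ≤ C'(ε')·N_E^{ε'}. [difficulty: provable-now] -/
@[route_item "route-ABC-PlacewiseSzpiro", crux]
def PlacewisePayoff : Prop :=
  SingleTowerSzpiro → (∀ ε : ℝ, 0 < ε → ∃ C : ℝ, ∀ (W : WeierstrassCurve ℚ) [W.IsElliptic], Real.log (W.minimalDiscriminantNorm ℤ : ℝ) ≤ C * (W.conductorNorm ℤ : ℝ) ^ ε)

-- `PlacewisePayoff` holds: proved by `Summit.ABC.ABC.Theorems.placewisePayoff_proof` (its module imports this route file, so no `_holds` link can be stated here).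

/-- item stmt-ABC-22413 · support · rank 9 · open · by planner
sources: BombieriGubler2006, PastenThesis2014
[support] DECLARED RESIDUAL (not claimed, summit-strength given the cruxes): from the subexponential
rung and the two placewise bounds to abc — the re-summation step Σ_v λ_v(j_E) ≤ (6+ε) log N_E + C (=
generalized Szpiro) given each λ_v ≤ (6+ε) log N_E + C. [difficulty: open-problem] -/
@[route_item "route-ABC-PlacewiseSzpiro", crux]
def PlacewiseResidual : Prop :=
  (∀ ε : ℝ, 0 < ε → ∃ C : ℝ, ∀ (W : WeierstrassCurve ℚ) [W.IsElliptic], Real.log (W.minimalDiscriminantNorm ℤ : ℝ) ≤ C * (W.conductorNorm ℤ : ℝ) ^ ε) → SingleTowerSzpiro → ArchimedeanTower → _root_.ABC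

/-- item stmt-ABC-22414 · assembly · rank 1 · open · by planner
sources: BombieriGubler2006, PastenThesis2014
[assembly] SingleTowerSzpiro → ArchimedeanTower → PlacewisePayoff → PlacewiseResidual → ABC (pure
logic; the deciding theorem `closes` in glue.lean is the proof). -/
@[route_item "route-ABC-PlacewiseSzpiro"]
def Assembly : Prop :=
  SingleTowerSzpiro → ArchimedeanTower → PlacewisePayoff → PlacewiseResidual → _root_.ABC

/-! D-0027 §2.1 — DECIDING THEOREM (planner-authored via `route open/edit --closes-file`; by planner-abc-idea-2-g0-0 2026-08-27T20:48:15Z):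
its hypotheses are this route's items and its conclusion the sub-problem Statement (glue_lint), and it elaborates with this file. -/

@[closes "route-ABC-PlacewiseSzpiro"] theorem closes (h₁ : SingleTowerSzpiro) (h₂ : ArchimedeanTower) (hpay : PlacewisePayoff)
    (hres : PlacewiseResidual) : _root_.ABC :=
  hres (hpay h₁) h₁ h₂

end Summit.ABC.ABC.Theses.PlacewiseSzpiro
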